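import Mathlib
import Summits.ResolutionOfSingularities.ResolutionOfSingularities.Theorems.HomologicalConductorPersistenceStaircaseSyzygy
import HarnessLib

/-!
# Rung S-2 `PersistenceSurface` (stmt-19970), stub C1 (`Sat₄`) — the STAIRCASE RESOLUTION over
# `U = k[u,v]^{μ_n(1,q)}`: a piece `M_a` generated by a monomial staircase `g_0, …, g_μ` has the product of pieces
# `Π_{t<μ} M_{ψ_t}` (`ψ_t = a − wt(u^{c_t} v^{j_{t+1}})`) as a FIRST SYZYGY module
# (chain W4.4b, seat res-L1-w44b-stub-4 gen 6; T-V package part 21 = SYZYGY-PLAN S3, module packaging)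

[OURS · L1 w44b · rung S-2] Nothing here is a statement of the manuscript under review (Hironaka 2017);
AI-written, weaker than expert review.

Part 20 (`…PersistenceStaircaseSyzygy`) proved at the level of polynomials that the relations among staircase
monomials `g_s = u^{c_s} v^{j_s}` (`c` non-increasing, `j` non-decreasing) with `σ₀`-invariant coefficients are
exactly the consecutive ones, with quotients `r_t` in the weight class `ψ_t = a − (c_t + q j_{t+1})`.  This file is
the module packaging consumed by parts 17–19:

* **`isSyzygy_one_staircase`** — for the `σ₀`-eigen-pieces `M b ⊆ k[u,v]|_U` (any family with
  `p ∈ M b ↔ σ₀ p = ζ^b p`; part 18 provides the canonical one), a weight class `a`, and a staircase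
  `(c_s, j_s)_{s ≤ μ}` of class `a` whose monomials generate `M a` over `U`:
  **`IsSyzygy 1 (M a) (Π_{t : Fin μ} M (a − (c_t + q j_{t+1})))`** — the short exact sequence
  `0 → Π_t M_{ψ_t} →ι U^{μ+1} →φ M_a → 0`, `φ(e_s) = g_s`,
  `ι(m)_s = v^{j_{s+1}−j_s} m_s − u^{c_{s−1}−c_s} m_{s−1}`.
With res-L1-w44b-idea-1's record staircase of `M_a` (SC-TORIC §2(e)(1)) this is the greedy syzygy formula
`Ω M_a ≅ ⊕_{d ∈ greedy(a)} M_{n−d}` in the kernel, for every `(n, q, a)`, in the shape `hK` of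
`…CyclicQuotientIsotypic.cohomologyAnnihilator_eq_four_of_isotypicData`; what then remains for `Sat₄` on the whole
cyclic class is the COMBINATORICS (records generate; drops = i-series; block lemma — SYZYGY-PLAN S1/S4/S5).

References: folklore (Hilbert–Burch-type resolution of a monomial staircase, taken isotypic part by isotypic part);
res-L1-w44b-idea-1 SC-TORIC v2 §2(e) (OURS, memo) for the statement being typed.
-/

-- single-problem summit: the doubled namespace component `ResolutionOfSingularities` is forced
set_option linter.dupNamespace false

noncomputable section

open CategoryTheory Literature.RingTheory.CohomologyAnnihilator MvPolynomial
open Summit.ResolutionOfSingularities.ResolutionOfSingularities.Theorems.HomologicalConductor.PersistenceCyclicQuotientSurface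
open Summit.ResolutionOfSingularities.ResolutionOfSingularities.Theorems.HomologicalConductor.PersistenceCyclicQuotientIsotypicPieces
open Summit.ResolutionOfSingularities.ResolutionOfSingularities.Theorems.HomologicalConductor.PersistenceStaircaseSyzygy

universe u

namespace Summit.ResolutionOfSingularities.ResolutionOfSingularities.Theorems.HomologicalConductor.PersistenceStaircaseResolution

variable {k : Type u} [Field k] {n : ℕ} [NeZero n] {ζ : k} (hζ : IsPrimitiveRoot ζ n) (q : ℕ)
variable (U : Subalgebra k (MvPolynomial (Fin 2) k))
variable (hU : ∀ p, p ∈ U ↔ aeval (fun i : Fin 2 => C (ζ ^ (![1, q] : Fin 2 → ℕ) i) * X i) p = p)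
variable (M : ZMod n → Submodule U ((restrictScalarsFunctor U (MvPolynomial (Fin 2) k)).obj
  (ModuleCat.of (MvPolynomial (Fin 2) k) (MvPolynomial (Fin 2) k))))
variable (hM : ∀ (a : ZMod n) (p : MvPolynomial (Fin 2) k),
  (show ((restrictScalarsFunctor U (MvPolynomial (Fin 2) k)).obj
    (ModuleCat.of (MvPolynomial (Fin 2) k) (MvPolynomial (Fin 2) k))) from p) ∈ M a ↔
  aeval (fun i : Fin 2 => C (ζ ^ (![1, q] : Fin 2 → ℕ) i) * X i) p = C (ζ ^ a.val) * p)

include hζ hU hM in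
/-- **Multiplication by a monomial of complementary class maps a piece `U`-linearly into `U`**: for `ψ + wt(e) = 0`
there is `f : M ψ →ₗ[U] U` with `f m = m · u^{e₀}v^{e₁}`. [folklore] -/
theorem exists_mul_monomial_linearMap (ψ : ZMod n) (e : Fin 2 →₀ ℕ) (he : ψ + ((e 0 + q * e 1 : ℕ) : ZMod n) = 0) :
    ∃ f : M ψ →ₗ[U] U, ∀ m : M ψ,
      ((f m : U) : MvPolynomial (Fin 2) k) =
        (show MvPolynomial (Fin 2) k from
          (m : (restrictScalarsFunctor U (MvPolynomial (Fin 2) k)).obj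
            (ModuleCat.of (MvPolynomial (Fin 2) k) (MvPolynomial (Fin 2) k)))) * monomial e 1 := by
  classical
  set σ₀ := aeval (R := k) (fun i : Fin 2 => C (ζ ^ (![1, q] : Fin 2 → ℕ) i) * X i) with hσ₀
  let ofW : ((restrictScalarsFunctor U (MvPolynomial (Fin 2) k)).obj
      (ModuleCat.of (MvPolynomial (Fin 2) k) (MvPolynomial (Fin 2) k))) → MvPolynomial (Fin 2) k := fun w => w
  have hfix : ∀ m : M ψ, σ₀ (ofW (m : _) * monomial e 1) = ofW (m : _) * monomial e 1 := by
    intro m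
    have hm : σ₀ (ofW (m : _)) = C (ζ ^ ψ.val) * ofW (m : _) := (hM ψ _).mp m.2
    rw [map_mul, hm, hσ₀, rootAut_monomial]
    have hpow : ζ ^ ψ.val * ζ ^ (e 0 + q * e 1) = 1 := by
      rw [← pow_add, (hζ.pow_eq_one_iff_dvd _), ← ZMod.natCast_eq_zero_iff, Nat.cast_add, ZMod.natCast_val,
        ZMod.cast_id', id]
      exact he
    calc C (ζ ^ ψ.val) * ofW (m : _) * (C (ζ ^ (e 0 + q * e 1)) * monomial e 1)
        = C (ζ ^ ψ.val * ζ ^ (e 0 + q * e 1)) * (ofW (m : _) * monomial e 1) := by rw [C_mul]; ring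
      _ = ofW (m : _) * monomial e 1 := by rw [hpow, C_1, one_mul]
  refine ⟨{ toFun := fun m => ⟨ofW (m : _) * monomial e 1, (hU _).mpr (hfix m)⟩
            map_add' := fun m m' => Subtype.ext (by
              change (ofW (m : _) + ofW (m' : _)) * monomial e 1 = ofW (m : _) * monomial e 1 + ofW (m' : _) * monomial e 1
              rw [add_mul])
            map_smul' := fun c m => Subtype.ext (by
              change ((c : MvPolynomial (Fin 2) k) * ofW (m : _)) * monomial e 1 =
                (c : MvPolynomial (Fin 2) k) * (ofW (m : _) * monomial e 1)
              rw [mul_assoc]) }, fun m => rfl⟩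

include hζ in
/-- If `σ₀ p = ζ^ψ p` and `ψ + wt(e) = 0` then `u^{e₀}v^{e₁} · p` is `σ₀`-invariant. [folklore] -/
theorem rootAut_monomial_mul_eq_self (ψ : ZMod n) (e : Fin 2 →₀ ℕ) (he : ψ + ((e 0 + q * e 1 : ℕ) : ZMod n) = 0)
    (p : MvPolynomial (Fin 2) k)
    (hp : aeval (fun i : Fin 2 => C (ζ ^ (![1, q] : Fin 2 → ℕ) i) * X i) p = C (ζ ^ ψ.val) * p) :
    aeval (fun i : Fin 2 => C (ζ ^ (![1, q] : Fin 2 → ℕ) i) * X i) (monomial e 1 * p) = monomial e 1 * p := by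
  rw [map_mul, hp, rootAut_monomial]
  have hpow : ζ ^ (e 0 + q * e 1) * ζ ^ ψ.val = 1 := by
    rw [← pow_add, (hζ.pow_eq_one_iff_dvd _), ← ZMod.natCast_eq_zero_iff, Nat.cast_add, ZMod.natCast_val,
      ZMod.cast_id', id, add_comm]
    exact he
  calc C (ζ ^ (e 0 + q * e 1)) * monomial e 1 * (C (ζ ^ ψ.val) * p)
      = C (ζ ^ (e 0 + q * e 1) * ζ ^ ψ.val) * (monomial e 1 * p) := by rw [C_mul]; ring
    _ = monomial e 1 * p := by rw [hpow, C_1, one_mul]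

set_option maxHeartbeats 800000 in
set_option synthInstance.maxHeartbeats 400000 in
include hζ hU hM in
/-- **THE STAIRCASE RESOLUTION.**  Let `(c_s, j_s)` be a staircase (`c` non-increasing, `j` non-decreasing), all
`g_s = u^{c_s} v^{j_s}` of weight class `a`, and suppose `g_0, …, g_μ` generate the piece `M a` over `U`.  Then the
product `Π_{t<μ} M (ψ t)`, `ψ t = a − (c_t + q j_{t+1})` (supplied as a function with that property, e.g. the
drop classes `n − d_t`), is a first syzygy module of `M a`:
`0 → Π_t M_{ψ_t} → U^{μ+1} → M_a → 0` with `e_s ↦ g_s` and `(m_t) ↦ (v^{Δj_s} m_s − u^{Δc_{s−1}} m_{s−1})_s`.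
(Budgets raised locally: instance search for `•` on elements of a submodule of `k[u,v]|_U` over the subalgebra
`U`, and the total elaboration of this one long proof, exceed the defaults; no `decide`, no heavy automation.)
[OURS · L1 w44b; folklore mechanism] -/
theorem isSyzygy_one_staircase (a : ZMod n) (μ : ℕ) (c j : ℕ → ℕ) (hc : Antitone c) (hj : Monotone j)
    (hcl : ∀ s, ((c s + q * j s : ℕ) : ZMod n) = a) (ψ : ℕ → ZMod n)
    (hψ : ∀ t, ψ t = a - ((c t + q * j (t + 1) : ℕ) : ZMod n))
    (hgen : M a ≤ Submodule.span U (Set.range fun s : Fin (μ + 1) =>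
      (show ((restrictScalarsFunctor U (MvPolynomial (Fin 2) k)).obj
        (ModuleCat.of (MvPolynomial (Fin 2) k) (MvPolynomial (Fin 2) k))) from
          monomial (Finsupp.single 0 (c s) + Finsupp.single 1 (j s)) (1 : k)))) :
    IsSyzygy 1 (@ModuleCat.of U _ (M a) _ (M a).module) (ModuleCat.of U (Π t : Fin μ, M (ψ t))) := by
  classical
  set σ₀ := aeval (R := k) (fun i : Fin 2 => C (ζ ^ (![1, q] : Fin 2 → ℕ) i) * X i) with hσ₀
  let toW : MvPolynomial (Fin 2) k → ((restrictScalarsFunctor U (MvPolynomial (Fin 2) k)).obj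
      (ModuleCat.of (MvPolynomial (Fin 2) k) (MvPolynomial (Fin 2) k))) := fun v => v
  let ofW : ((restrictScalarsFunctor U (MvPolynomial (Fin 2) k)).obj
      (ModuleCat.of (MvPolynomial (Fin 2) k) (MvPolynomial (Fin 2) k))) → MvPolynomial (Fin 2) k := fun w => w
  let ofWh : ((restrictScalarsFunctor U (MvPolynomial (Fin 2) k)).obj
      (ModuleCat.of (MvPolynomial (Fin 2) k) (MvPolynomial (Fin 2) k))) →+ MvPolynomial (Fin 2) k :=
    { toFun := ofW, map_zero' := rfl, map_add' := fun _ _ => rfl }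
  have ofWh_apply : ∀ w, ofWh w = ofW w := fun _ => rfl
  let g : ℕ → MvPolynomial (Fin 2) k := fun s => monomial (Finsupp.single 0 (c s) + Finsupp.single 1 (j s)) 1
  have hζn : ζ ^ n = 1 := hζ.pow_eq_one
  -- the generators lie in `M a`
  have hg_mem : ∀ s, toW (g s) ∈ M a := by
    intro s
    rw [hM a (g s)]
    change σ₀ (monomial _ 1) = _
    rw [hσ₀, rootAut_monomial]
    congr 2
    rw [pow_eq_pow_iff_modEq_of_isPrimitiveRoot hζ, ← ZMod.natCast_eq_natCast_iff, ZMod.natCast_val, ZMod.cast_id',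
      id, ← hcl s]
    simp
  -- class bookkeeping for the two coordinate maps
  have hψA : ∀ t, ψ t + (((Finsupp.single 1 (j (t + 1) - j t) : Fin 2 →₀ ℕ) 0 +
      q * (Finsupp.single 1 (j (t + 1) - j t) : Fin 2 →₀ ℕ) 1 : ℕ) : ZMod n) = 0 := by
    intro t
    have hjt : j t ≤ j (t + 1) := hj (Nat.le_succ t)
    simp only [Finsupp.single_eq_of_ne (zero_ne_one), Finsupp.single_eq_same, zero_add, hψ t]
    rw [← hcl t]
    push_cast [Nat.cast_sub hjt]
    ring
  have hψB : ∀ t, ψ t + (((Finsupp.single 0 (c t - c (t + 1)) : Fin 2 →₀ ℕ) 0 +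
      q * (Finsupp.single 0 (c t - c (t + 1)) : Fin 2 →₀ ℕ) 1 : ℕ) : ZMod n) = 0 := by
    intro t
    have hct : c (t + 1) ≤ c t := hc (Nat.le_succ t)
    simp only [Finsupp.single_eq_of_ne (one_ne_zero), Finsupp.single_eq_same, mul_zero, add_zero, hψ t]
    rw [← hcl (t + 1)]
    push_cast [Nat.cast_sub hct]
    ring
  -- polynomial readings of a tuple `m` and the coordinates of `ι m`
  obtain ⟨r, er⟩ : ∃ r : (Π t : Fin μ, M (ψ t)) → ℕ → MvPolynomial (Fin 2) k,
      ∀ m t, r m t = if h : t < μ then ofW (m ⟨t, h⟩ : _) else 0 := ⟨_, fun _ _ => rfl⟩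
  have hr_ge : ∀ m t, μ ≤ t → r m t = 0 := fun m t ht => by rw [er, dif_neg (not_lt.mpr ht)]
  have hrσ : ∀ m t, σ₀ (r m t) = C (ζ ^ (ψ t).val) * r m t := by
    intro m t
    rw [er]
    by_cases h : t < μ
    · rw [dif_pos h]; exact (hM (ψ t) _).mp (m ⟨t, h⟩).2
    · rw [dif_neg h, map_zero, mul_zero]
  have hr_add : ∀ m m' t, r (m + m') t = r m t + r m' t := by
    intro m m' t
    rw [er, er, er]
    by_cases h : t < μ
    · rw [dif_pos h, dif_pos h, dif_pos h]; rfl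
    · rw [dif_neg h, dif_neg h, dif_neg h, add_zero]
  have hr_smul : ∀ (x : U) (m m' : Π t : Fin μ, M (ψ t)),
      (∀ t (h : t < μ), ofW (m' ⟨t, h⟩ : _) = (x : MvPolynomial (Fin 2) k) * ofW (m ⟨t, h⟩ : _)) →
      ∀ t, r m' t = (x : MvPolynomial (Fin 2) k) * r m t := by
    intro x m m' hmm' t
    rw [er, er]
    by_cases h : t < μ
    · rw [dif_pos h, dif_pos h, hmm' t h]
    · rw [dif_neg h, dif_neg h, mul_zero]
  obtain ⟨wc, ewc⟩ : ∃ wc : (Π t : Fin μ, M (ψ t)) → ℕ → MvPolynomial (Fin 2) k, ∀ m s, wc m s =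
      monomial (Finsupp.single 1 (j (s + 1) - j s)) 1 * r m s -
        if s = 0 then 0 else monomial (Finsupp.single 0 (c (s - 1) - c s)) 1 * r m (s - 1) :=
    ⟨_, fun _ _ => rfl⟩
  have hwc_fix : ∀ m s, σ₀ (wc m s) = wc m s := by
    intro m s
    rw [ewc, map_sub, rootAut_monomial_mul_eq_self hζ q (ψ s) _ (hψA s) (r m s) (hrσ m s)]
    by_cases hs : s = 0
    · rw [if_pos hs, map_zero]
    · obtain ⟨t, rfl⟩ : ∃ t, s = t + 1 := ⟨s - 1, by omega⟩
      rw [if_neg hs, Nat.add_sub_cancel, rootAut_monomial_mul_eq_self hζ q (ψ t) _ (hψB t) (r m t) (hrσ m t)]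
  have hwc_add : ∀ m m' s, wc (m + m') s = wc m s + wc m' s := by
    intro m m' s
    rw [ewc, ewc, ewc, hr_add, hr_add]
    by_cases hs : s = 0
    · rw [if_pos hs, if_pos hs, if_pos hs]; ring
    · rw [if_neg hs, if_neg hs, if_neg hs]; ring
  have hwc_smul : ∀ (x : U) (m m' : Π t : Fin μ, M (ψ t)),
      (∀ t (h : t < μ), ofW (m' ⟨t, h⟩ : _) = (x : MvPolynomial (Fin 2) k) * ofW (m ⟨t, h⟩ : _)) →
      ∀ s, wc m' s = (x : MvPolynomial (Fin 2) k) * wc m s := by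
    intro x m m' hmm' s
    rw [ewc, ewc, hr_smul x m m' hmm', hr_smul x m m' hmm']
    by_cases hs : s = 0
    · rw [if_pos hs, if_pos hs]; ring
    · rw [if_neg hs, if_neg hs]; ring
  -- the syzygy map `ι`
  let ι : (Π t : Fin μ, M (ψ t)) →ₗ[U] (Fin (μ + 1) → U) :=
    { toFun := fun m s => ⟨wc m s, (hU _).mpr (hwc_fix m s)⟩
      map_add' := fun m m' => funext fun s => Subtype.ext (by
        change wc (m + m') s = wc m s + wc m' s
        exact hwc_add m m' s)
      map_smul' := fun x m => funext fun s => Subtype.ext (hwc_smul x m _ (fun _ _ => rfl) s) }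
  have hι : ∀ m (s : Fin (μ + 1)), ((ι m s : U) : MvPolynomial (Fin 2) k) =
      monomial (Finsupp.single 1 (j (s + 1) - j s)) 1 * r m s -
        if (s : ℕ) = 0 then 0 else monomial (Finsupp.single 0 (c (s - 1) - c s)) 1 * r m (s - 1) :=
    fun m s => ewc m s
  -- the presentation map `φ`
  let gen : Fin (μ + 1) → M a := fun s => ⟨toW (g s), hg_mem s⟩
  let φ : (Fin (μ + 1) → U) →ₗ[U] M a := Fintype.linearCombination U gen
  have hφ : ∀ w : Fin (μ + 1) → U, ofW ((φ w : M a) : _) = ∑ s : Fin (μ + 1), (w s : MvPolynomial (Fin 2) k) * g s := by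
    intro w
    change ofW ((Fintype.linearCombination U gen w : M a) : _) = _
    rw [Fintype.linearCombination_apply, Submodule.coe_sum, ← ofWh_apply, map_sum]
    exact Finset.sum_congr rfl fun s _ => rfl
  -- the `ℕ`-indexed reading of a coefficient vector
  obtain ⟨ext, hext, hext'⟩ : ∃ ext : (Fin (μ + 1) → U) → ℕ → MvPolynomial (Fin 2) k,
      (∀ w (s : Fin (μ + 1)), ext w s = ((w s : U) : MvPolynomial (Fin 2) k)) ∧
      (∀ w s, ¬ s < μ + 1 → ext w s = 0) := by
    refine ⟨fun w => Function.extend Fin.val (fun s => ((w s : U) : MvPolynomial (Fin 2) k)) 0,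
      fun w s => Fin.val_injective.extend_apply _ _ s, fun w s hs => ?_⟩
    change Function.extend Fin.val _ 0 s = 0
    rw [Function.extend_apply' _ _ _ (fun ⟨t, ht⟩ => hs (ht ▸ t.isLt)), Pi.zero_apply]
  have hφ' : ∀ w : Fin (μ + 1) → U, ofW ((φ w : M a) : _) = ∑ s ∈ Finset.range (μ + 1), ext w s * g s := by
    intro w
    have h1 : ∑ s ∈ Finset.range (μ + 1), ext w s * g s = ∑ s : Fin (μ + 1), ext w s * g s :=
      Finset.sum_range (fun s => ext w s * g s)
    have h2 : ∑ s : Fin (μ + 1), ext w s * g s =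
        ∑ s : Fin (μ + 1), ((w s : U) : MvPolynomial (Fin 2) k) * g s :=
      Finset.sum_congr rfl fun s _ => congrArg (fun x => x * g s) (hext w s)
    rw [h1, h2]
    exact hφ w
  -- (1) `ι` is injective
  have hinj : Function.Injective ι := by
    intro m m' hmm'
    rw [← sub_eq_zero] at hmm' ⊢
    set d := m - m' with hd
    have hd0 : ι d = 0 := by rw [hd, map_sub, hmm']
    have hcoords : ∀ s, s ≤ μ → (monomial (Finsupp.single 1 (j (s + 1) - j s)) 1 * r d s -
        if s = 0 then 0 else monomial (Finsupp.single 0 (c (s - 1) - c s)) 1 * r d (s - 1) : MvPolynomial (Fin 2) k) = 0 := by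
      intro s hs
      have := hι d ⟨s, Nat.lt_succ_of_le hs⟩
      rw [hd0, Pi.zero_apply, Subalgebra.coe_zero] at this
      exact this.symm
    funext t
    apply Subtype.ext
    have h0 := eq_zero_of_stair_coords_eq_zero c j hc hj (r d) μ hcoords t (le_of_lt t.isLt)
    rw [er, dif_pos t.isLt] at h0
    exact h0
  -- (2) `φ` is surjective
  have hsurj : Function.Surjective φ := by
    intro x
    have hx := hgen x.2
    rw [Submodule.mem_span_range_iff_exists_fun] at hx
    obtain ⟨w, hw⟩ := hx
    refine ⟨w, Subtype.ext ?_⟩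
    change (Fintype.linearCombination U gen w : M a).val = x.val
    rw [Fintype.linearCombination_apply, Submodule.coe_sum]
    rw [← hw]
    exact Finset.sum_congr rfl fun s _ => rfl
  -- (3) exactness in the middle
  have hexact : Function.Exact ι φ := by
    rw [LinearMap.exact_iff]
    apply le_antisymm
    · -- `ker φ ≤ range ι`
      intro w hw
      rw [LinearMap.mem_ker] at hw
      have hrel : ∑ s ∈ Finset.range (μ + 1), ext w s * g s = 0 := by
        rw [← hφ' w, hw]; rfl
      obtain ⟨ρ, hρμ, hSρ, hcoord⟩ := exists_stair_preimage c j hc hj (ext w) μ hrel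
      -- classes of the quotients
      have hinv : ∀ s, σ₀ (ext w s) = ext w s := by
        intro s
        by_cases h : s < μ + 1
        · rw [show s = ((⟨s, h⟩ : Fin (μ + 1)) : ℕ) from rfl, hext]
          exact (hU _).mp (w ⟨s, h⟩).2
        · rw [hext' w s h, map_zero]
      have hρcl : ∀ t, t < μ → σ₀ (ρ t) = C (ζ ^ (ψ t).val) * ρ t := fun t ht => by
        rw [hψ t]
        exact rootAut_stair_quotient hζ q c j a (ext w) ρ t (fun s _ => hinv s) (fun s _ => hcl s) (hSρ t ht)
      let m : Π t : Fin μ, M (ψ t) := fun t => ⟨toW (ρ t), (hM (ψ t) (ρ t)).mpr (hρcl t t.isLt)⟩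
      have hrm : ∀ t, r m t = ρ t := by
        intro t
        rw [er]
        by_cases h : t < μ
        · rw [dif_pos h]
        · rw [dif_neg h, hρμ t (not_lt.mp h)]
      refine ⟨m, ?_⟩
      funext s
      apply Subtype.ext
      rw [hι m s, ← hext w s, hcoord s (Nat.le_of_lt_succ s.isLt), hrm, hrm]
    · -- `range ι ≤ ker φ`
      rintro _ ⟨m, rfl⟩
      rw [LinearMap.mem_ker]
      apply Subtype.ext
      apply (show Function.Injective ofW from fun _ _ h => h)
      rw [hφ' (ι m)]
      change _ = (0 : MvPolynomial (Fin 2) k)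
      refine sum_mul_stair_eq_zero_of_eq c j hc hj (ext (ι m)) (r m) μ (hr_ge m) fun s hs => ?_
      rw [hext (ι m) ⟨s, Nat.lt_succ_of_le hs⟩, hι m ⟨s, Nat.lt_succ_of_le hs⟩]
  -- (4) package
  obtain ⟨w, hS⟩ := exists_shortExact_of_linearMap
    (Y := ModuleCat.of U (Π t : Fin μ, M (ψ t))) (M := ModuleCat.of U (Fin (μ + 1) → U))
    (X := @ModuleCat.of U _ (M a) _ (M a).module) ι φ hinj hsurj hexact
  exact isSyzygy_one_iff.mpr ⟨ModuleCat.of U (Fin (μ + 1) → U), inferInstance,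
    (IsProjective.iff_projective (R := U) (Fin (μ + 1) → U)).mp inferInstance, _, _, w, hS⟩

end Summit.ResolutionOfSingularities.ResolutionOfSingularities.Theorems.HomologicalConductor.PersistenceStaircaseResolution

end
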